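import Summits.MatrixMultiplication.OmegaCensus.SmallFormats.InvertiblePointNearFrame
import HarnessLib

/-!
# ω-census family (a): NO DEAD COLUMN in `span{W_t : t ∈ Z}` at a (near-)frame point of `⟨2,2,n⟩`

Cell `pub-omega` (unit `pub-omega-tensor-g25`), topic `Summits/MatrixMultiplication/OmegaCensus` (sub-folder `SmallFormats`).
Framing (verbatim): lottery ticket; floor = certified bounds/negative ranges. HONEST FRAMING: an elementary structural lemma over an
arbitrary field on top of `InvertiblePointNearFrame` (p493611); it is the kernel form of `NEAR-STRUCTURE.md` §6 (tensor g25) and supplies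
the 'no `L₀` block' convention of the footprint filter (`IP-LAW.md` §2, tensor g23) with a proof that ALSO covers the near-frame case:
at `X₀ = 1` with the rank-one frame data `f_s(1) g_s(W_j) = δ_{sj} + ρ_s σ_j` (saturated case: `ρ = σ = 0`; near case:
`exists_nearFrame`), NO column `q` can vanish on every output `W_t` of the terms `t ∉ O` (`near_no_dead_column`). In the near-frame search
stage of the `𝔽₃` `⟨2,2,6⟩ @ 20` census this says: the hyperplane `𝒲′ = span{W_t : t ∈ Z}` of the type space `𝒲⁺` is never '`𝒲⁺` minus a
line column' (OMEGA-LAW.md: the single-line-coordinate functionals ω are excluded). Not a rank bound; nothing on `ω`.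

**Proof.** If column `q` of every `W_t` (`t ∉ O`) vanished, column `q` of the near footprint identity (`near_footprint_w_eq`) would read
`X w_j − c_j(X) w_j = σ_j · D(X)` for all `X` (`w_j :=` column `q` of `W_j`, `D(X) := Σ_s ρ_s c_s(X) w_s`, `c_s := f_s/f_s(1)`), while the
`w_j` (`j ∈ O`) span `k²` ((N1)). Then: `w_j ≠ 0 ⇒ σ_j ≠ 0` (else `w_j` would be an eigenvector of every `X`); for independent `w₁, w₂`
the projector `P` onto `k·w₂` along `k·w₁` has `D(P) = 0`, which forces every nonzero `w_j` onto `k·w₁ ∪ k·w₂`; two nonzero `w`'s on one line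
have the SAME class (`c_j = c_i`); so the off classes seeing column `q` are at most two functionals `c₁, c₂`, which cannot separate `M₂(k)`
— yet column `q` of Brent's identity says they do (`X·y = Σ_s f_s(X) g_s(Y) w_s`). Contradiction.
-/

namespace Summit.MatrixMultiplication.OmegaCensus.SmallFormats

open Module Matrix Literature.Computability.AlgebraicComplexity

variable {k : Type*} [Field k] {n : ℕ} {ι : Type*} [Fintype ι]

/-- `(u vᵀ) w = (v·w) u`. -/
theorem vecMulVec_mulVec_eq_smul (u v w : Fin 2 → k) : vecMulVec u v *ᵥ w = (v ⬝ᵥ w) • u := by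
  ext y
  simp only [mulVec, dotProduct, vecMulVec_apply, Pi.smul_apply, smul_eq_mul, Fin.sum_univ_two]
  ring

/-- The `2 × 2` cross product `Δ(u,v) = u₀ v₁ − u₁ v₀`: if `u ≠ 0` and `Δ(u,v) = 0` then `v` is a multiple of `u`. -/
theorem exists_smul_of_cross_eq_zero {u v : Fin 2 → k} (hu : u ≠ 0) (h : u 0 * v 1 - u 1 * v 0 = 0) :
    ∃ t : k, v = t • u := by
  by_cases h0 : u 0 = 0
  · have h1 : u 1 ≠ 0 := by
      intro h1; apply hu; funext r; fin_cases r <;> assumption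
    refine ⟨v 1 * (u 1)⁻¹, ?_⟩
    funext r; fin_cases r
    · simp only [Fin.zero_eta, Pi.smul_apply, smul_eq_mul]
      rw [h0] at h ⊢
      have : u 1 * v 0 = 0 := by linear_combination -h
      rcases mul_eq_zero.mp this with h' | h'
      · exact absurd h' h1
      · rw [h', mul_zero]
    · simp only [Fin.mk_one, Pi.smul_apply, smul_eq_mul]
      field_simp
  · refine ⟨v 0 * (u 0)⁻¹, ?_⟩
    funext r; fin_cases r
    · simp only [Fin.zero_eta, Pi.smul_apply, smul_eq_mul]; field_simp
    · simp only [Fin.mk_one, Pi.smul_apply, smul_eq_mul]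
      field_simp
      linear_combination h

/-- Dual basis of two vectors with nonzero cross product: `v = (d′·v) w₁ + (d·v) w₂` with `d′ = Δ⁻¹ (w₂₁, −w₂₀)`, `d = Δ⁻¹ (−w₁₁, w₁₀)`. -/
theorem eq_dual_coords (w₁ w₂ v : Fin 2 → k) (hΔ : w₁ 0 * w₂ 1 - w₁ 1 * w₂ 0 ≠ 0) :
    v = (((w₁ 0 * w₂ 1 - w₁ 1 * w₂ 0)⁻¹ • ![w₂ 1, -w₂ 0]) ⬝ᵥ v) • w₁ +
        (((w₁ 0 * w₂ 1 - w₁ 1 * w₂ 0)⁻¹ • ![-w₁ 1, w₁ 0]) ⬝ᵥ v) • w₂ := by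
  funext r
  simp only [Pi.add_apply, Pi.smul_apply, smul_eq_mul, dotProduct, Fin.sum_univ_two, Matrix.cons_val_zero,
    Matrix.cons_val_one]
  fin_cases r <;> simp <;> field_simp <;> ring

/-- A vector `u` with `Δ(a,u) ≠ 0` exists for every `a ≠ 0` (take a coordinate vector). -/
theorem exists_cross_ne_zero {a : Fin 2 → k} (ha : a ≠ 0) : ∃ u : Fin 2 → k, a 0 * u 1 - a 1 * u 0 ≠ 0 := by
  by_cases h0 : a 0 = 0
  · have h1 : a 1 ≠ 0 := by
      intro h1; apply ha; funext r; fin_cases r <;> assumption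
    exact ⟨Pi.single 0 1, by simp [h1]⟩
  · exact ⟨Pi.single 1 1, by simp [h0]⟩

/-- Column `q` of a matrix product is the matrix applied to column `q`. -/
theorem mul_apply_col (X : Matrix (Fin 2) (Fin 2) k) (W : Matrix (Fin 2) (Fin n) k) (r : Fin 2) (q : Fin n) :
    (X * W) r q = (X *ᵥ fun r' => W r' q) r := by
  simp [Matrix.mul_apply, mulVec, dotProduct]

/-- **No dead column (NEAR-STRUCTURE.md §6).** At `X₀ = 1` with rank-one frame data `f_s(1) g_s(W_j) = δ_{sj} + ρ_s σ_j`
(`s, j ∈ O`; near case: `exists_nearFrame`; saturated case: `ρ = σ = 0`, i.e. `frame_coeff`), no column `q` vanishes on all outputs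
`W_t`, `t ∉ O`. Equivalently: `span{W_t : t ∉ O}` has full column support — for the census, the hyperplane `𝒲′` of the near type space is
never the type space minus a line column. -/
theorem near_no_dead_column [DecidableEq ι] (β : BilinComp (mulBilin k 2 2 n) ι) (O : Finset ι)
    (hO : ∀ i, i ∉ O → β.f i 1 = 0) (hO' : ∀ i ∈ O, β.f i 1 ≠ 0) {ρ σ : ι → k}
    (hM : ∀ s ∈ O, ∀ j ∈ O, β.f s 1 * β.g s (β.w j) = (if s = j then 1 else 0) + ρ s * σ j) (q : Fin n) :
    ¬ ∀ t, t ∉ O → ∀ r, β.w t r q = 0 := by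
  classical
  intro hq
  -- notation: `w j` = column `q` of `W_j`, `c j X = f_j(X)/f_j(1)`, `D X = Σ_s ρ_s c_s(X) w_s`
  set w : ι → (Fin 2 → k) := fun j r => β.w j r q with hw
  set c : ι → Matrix (Fin 2) (Fin 2) k → k := fun j X => β.f j X * (β.f j 1)⁻¹ with hc
  set D : Matrix (Fin 2) (Fin 2) k → (Fin 2 → k) := fun X => ∑ s ∈ O, (ρ s * c s X) • w s with hD
  have hc1 : ∀ j ∈ O, c j 1 = 1 := fun j hj => by simp only [hc]; exact mul_inv_cancel₀ (hO' j hj)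
  -- (**): column `q` of the near footprint identity
  have hfp : ∀ j ∈ O, ∀ X : Matrix (Fin 2) (Fin 2) k, X *ᵥ w j - c j X • w j = σ j • D X := by
    intro j hj X
    have h := near_footprint_w_eq β O hO' hM hj X
    funext r
    have hr := congr_fun (congr_fun h r) q
    have hR : (∑ t ∈ Finset.univ \ O, (β.f t X * β.g t (β.w j)) • β.w t) r q = 0 := by
      rw [Matrix.sum_apply]
      exact Finset.sum_eq_zero fun t ht => by
        rw [Matrix.smul_apply, smul_eq_mul, hq t (Finset.mem_sdiff.mp ht).2 r, mul_zero]
    rw [hR, Matrix.sub_apply, Matrix.sub_apply, Matrix.smul_apply, smul_eq_mul, Matrix.smul_apply, smul_eq_mul,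
      Matrix.sum_apply, mul_apply_col] at hr
    simp only [Pi.sub_apply, Pi.smul_apply, smul_eq_mul, hD, Finset.sum_apply, hw, hc]
    have : ∑ s ∈ O, ((ρ s * (β.f s X * (β.f s 1)⁻¹)) • β.w s) r q = ∑ s ∈ O, ρ s * (β.f s X * (β.f s 1)⁻¹) * β.w s r q :=
      Finset.sum_congr rfl fun s _ => by rw [Matrix.smul_apply, smul_eq_mul]
    rw [this] at hr
    linear_combination hr
  -- (N1), column `q`: every `y ∈ k²` is a combination of the `w_s`, `s ∈ O`
  have hspan : ∀ y : Fin 2 → k, ∃ a : ι → k, y = ∑ s ∈ O, a s • w s := by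
    intro y
    let Y : Matrix (Fin 2) (Fin n) k := fun r c' => if c' = q then y r else 0
    refine ⟨fun s => β.f s 1 * β.g s Y, ?_⟩
    have h := eq_sum_off_one β O hO Y
    funext r
    rw [Finset.sum_apply]
    simp only [Pi.smul_apply, smul_eq_mul, hw]
    have hr := congr_fun (congr_fun h r) q
    simp only [Matrix.sum_apply, Matrix.smul_apply, smul_eq_mul] at hr
    have hYrq : Y r q = y r := by simp [Y]
    rw [hYrq] at hr
    exact hr
  -- cross products with the span: if every `w_s` is parallel to `a ≠ 0`, contradiction
  have hnotall : ∀ a : Fin 2 → k, a ≠ 0 → ¬ ∀ s ∈ O, a 0 * w s 1 - a 1 * w s 0 = 0 := by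
    intro a ha hall
    obtain ⟨u, hu⟩ := exists_cross_ne_zero ha
    obtain ⟨b, hb⟩ := hspan u
    apply hu
    rw [hb]
    simp only [Finset.sum_apply, Pi.smul_apply, smul_eq_mul, Finset.mul_sum, ← Finset.sum_sub_distrib]
    exact Finset.sum_eq_zero fun s hs => by linear_combination b s * hall s hs
  -- S2: some `w_{j₁} ≠ 0`
  have hex1 : ∃ j₁ ∈ O, w j₁ ≠ 0 := by
    by_contra hnone
    push Not at hnone
    obtain ⟨b, hb⟩ := hspan (Pi.single 0 1 : Fin 2 → k)
    have : (Pi.single 0 1 : Fin 2 → k) = 0 := by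
      rw [hb]; exact Finset.sum_eq_zero fun s hs => by rw [hnone s hs, smul_zero]
    have h0 := congr_fun this (0 : Fin 2)
    simp only [Pi.single_eq_same, Pi.zero_apply] at h0
    exact one_ne_zero h0
  obtain ⟨j₁, hj₁, hw₁⟩ := hex1
  -- S3: `w_j ≠ 0 ⇒ σ_j ≠ 0` (else `w_j` is an eigenvector of every `X`)
  have hσ : ∀ j ∈ O, w j ≠ 0 → σ j ≠ 0 := by
    intro j hj hwj hσj
    obtain ⟨u, hu⟩ := exists_cross_ne_zero hwj
    obtain ⟨r₀, hr₀⟩ := Function.ne_iff.mp hwj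
    have h := hfp j hj (vecMulVec u (Pi.single r₀ 1))
    rw [hσj, zero_smul, sub_eq_zero, vecMulVec_mulVec_eq_smul] at h
    -- `h : (e_{r₀}·w_j) • u = c • w_j`; cross with `w_j`
    have hcross := congrArg (fun v : Fin 2 → k => w j 0 * v 1 - w j 1 * v 0) h
    simp only [Pi.smul_apply, smul_eq_mul, single_dotProduct, one_mul] at hcross
    have : w j r₀ * (w j 0 * u 1 - w j 1 * u 0) = 0 := by linear_combination hcross
    rcases mul_eq_zero.mp this with h0 | h0
    · exact hr₀ h0
    · exact hu h0
  -- S4: a second, independent direction `w_{j₂}`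
  obtain ⟨j₂, hj₂, hΔ⟩ : ∃ j₂ ∈ O, w j₁ 0 * w j₂ 1 - w j₁ 1 * w j₂ 0 ≠ 0 := by
    by_contra h; push Not at h; exact hnotall (w j₁) hw₁ h
  set w₁ := w j₁ with hw₁def
  set w₂ := w j₂ with hw₂def
  set Δ := w₁ 0 * w₂ 1 - w₁ 1 * w₂ 0 with hΔdef
  have hw₂ : w₂ ≠ 0 := by intro h0; apply hΔ; rw [hΔdef, h0]; simp
  have hσ₁ := hσ j₁ hj₁ hw₁
  have hσ₂ := hσ j₂ hj₂ hw₂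
  -- dual basis
  set d : Fin 2 → k := Δ⁻¹ • ![-w₁ 1, w₁ 0] with hddef
  set d' : Fin 2 → k := Δ⁻¹ • ![w₂ 1, -w₂ 0] with hd'def
  have hd1 : d ⬝ᵥ w₁ = 0 := by
    simp only [hddef, dotProduct, Fin.sum_univ_two, Pi.smul_apply, smul_eq_mul, Matrix.cons_val_zero, Matrix.cons_val_one]
    ring
  have hd2 : d ⬝ᵥ w₂ = 1 := by
    simp only [hddef, dotProduct, Fin.sum_univ_two, Pi.smul_apply, smul_eq_mul, Matrix.cons_val_zero, Matrix.cons_val_one]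
    rw [hΔdef] at hΔ ⊢
    field_simp; ring
  have hcoords : ∀ v : Fin 2 → k, v = (d' ⬝ᵥ v) • w₁ + (d ⬝ᵥ v) • w₂ := fun v => eq_dual_coords w₁ w₂ v hΔ
  -- independence: `a • w₁ = b • w₂ ⇒ a = 0 ∧ b = 0`; `a • w₁ + b • w₂ = 0 ⇒ a = 0 ∧ b = 0`
  have hindep : ∀ a b : k, a • w₁ + b • w₂ = 0 → a = 0 ∧ b = 0 := by
    intro a b h
    have h1 := congrArg (fun v : Fin 2 → k => w₁ 0 * v 1 - w₁ 1 * v 0) h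
    have h2 := congrArg (fun v : Fin 2 → k => v 0 * w₂ 1 - v 1 * w₂ 0) h
    simp only [Pi.add_apply, Pi.smul_apply, smul_eq_mul, Pi.zero_apply, mul_zero, sub_zero, zero_mul] at h1 h2
    have hb : b * Δ = 0 := by rw [hΔdef]; linear_combination h1
    have ha : a * Δ = 0 := by rw [hΔdef]; linear_combination h2
    exact ⟨(mul_eq_zero.mp ha).resolve_right hΔ, (mul_eq_zero.mp hb).resolve_right hΔ⟩
  -- S5/S6: the projector `P` onto `k w₂` along `k w₁` has `D P = 0`, `c_{j₂}(P) = 1`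
  set P : Matrix (Fin 2) (Fin 2) k := vecMulVec w₂ d with hPdef
  have hP1 : P *ᵥ w₁ = 0 := by rw [hPdef, vecMulVec_mulVec_eq_smul, hd1, zero_smul]
  have hP2 : P *ᵥ w₂ = w₂ := by rw [hPdef, vecMulVec_mulVec_eq_smul, hd2, one_smul]
  have hDP : D P = 0 := by
    have h1 := hfp j₁ hj₁ P
    have h2 := hfp j₂ hj₂ P
    rw [← hw₁def, hP1, zero_sub] at h1
    rw [← hw₂def, hP2] at h2
    -- `σ₂ • h1` and `σ₁ • h2` give `-σ₂ c₁ • w₁ = σ₁ (1 - c₂) • w₂`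
    have h3 : (-(σ j₂ * c j₁ P)) • w₁ + (-(σ j₁ * (1 - c j₂ P))) • w₂ = 0 := by
      have e1 : σ j₂ • (-(c j₁ P • w₁)) = (σ j₂ * σ j₁) • D P := by rw [h1, smul_smul]
      have e2 : σ j₁ • (w₂ - c j₂ P • w₂) = (σ j₁ * σ j₂) • D P := by rw [h2, smul_smul]
      have e3 : σ j₂ • (-(c j₁ P • w₁)) = σ j₁ • (w₂ - c j₂ P • w₂) := by rw [e1, e2, mul_comm]
      have : σ j₂ • (-(c j₁ P • w₁)) - σ j₁ • (w₂ - c j₂ P • w₂) = 0 := sub_eq_zero.mpr e3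
      rw [← this]; module
    obtain ⟨ha, hb⟩ := hindep _ _ h3
    have hc1P : c j₁ P = 0 := by
      rcases mul_eq_zero.mp (neg_eq_zero.mp ha) with h0 | h0
      · exact absurd h0 hσ₂
      · exact h0
    rw [hc1P, zero_smul, neg_zero] at h1
    -- `h1 : 0 = σ j₁ • D P`
    have := (smul_eq_zero.mp h1.symm).resolve_left hσ₁
    exact this
  -- S7: every nonzero `w_j` lies on `k w₁` or on `k w₂`
  have hdir : ∀ j ∈ O, w j ≠ 0 → (d ⬝ᵥ w j = 0 ∧ w j = (d' ⬝ᵥ w j) • w₁) ∨ (d' ⬝ᵥ w j = 0 ∧ w j = (d ⬝ᵥ w j) • w₂) := by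
    intro j hj hwj
    have h := hfp j hj P
    rw [hDP, smul_zero, hPdef, vecMulVec_mulVec_eq_smul] at h
    -- `h : (d·w_j) • w₂ - c_j(P) • w_j = 0`; expand `w_j` in the dual basis
    set βj := d ⬝ᵥ w j with hβj
    set αj := d' ⬝ᵥ w j with hαj
    have hv : w j = αj • w₁ + βj • w₂ := by
      have := hcoords (w j); rwa [← hαj, ← hβj] at this
    have h' : (-(c j P * αj)) • w₁ + (βj - c j P * βj) • w₂ = 0 := by
      have h2 : βj • w₂ - c j P • (αj • w₁ + βj • w₂) = 0 := by
        have h3 := h; rw [hv] at h3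
        -- `rw` may also have rewritten inside `βj`/`αj`? they are opaque names now, so `h3` is the wanted identity
        exact h3
      rw [← h2]; module
    obtain ⟨ha, hb⟩ := hindep _ _ h'
    by_cases hβ : βj = 0
    · left
      refine ⟨hβ, ?_⟩
      rw [hv, hβ, zero_smul, add_zero]
    · right
      have hcP : c j P = 1 := by
        have : βj * (1 - c j P) = 0 := by linear_combination hb
        rcases mul_eq_zero.mp this with h0 | h0
        · exact absurd h0 hβ
        · linear_combination -h0
      have hα : αj = 0 := by
        rw [hcP, one_mul] at ha; exact neg_eq_zero.mp ha
      refine ⟨hα, ?_⟩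
      rw [hv, hα, zero_smul, zero_add]
  -- S8: two nonzero `w`'s on one line have the same class
  have hsame : ∀ i ∈ O, ∀ j ∈ O, w i ≠ 0 → ∀ t : k, t ≠ 0 → w j = t • w i → ∀ X, c j X = c i X := by
    intro i hi j hj hwi t ht hji X
    have hσi := hσ i hi hwi
    -- from (**) for `i` and `j`: `(σ_j − σ_i t) • X w_i = (σ_j c_i X − σ_i t c_j X) • w_i` for every `X`
    have key : ∀ Y : Matrix (Fin 2) (Fin 2) k,
        (σ j - σ i * t) • (Y *ᵥ w i) = (σ j * c i Y - σ i * t * c j Y) • w i := by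
      intro Y
      have h1 := hfp i hi Y
      have h2 := hfp j hj Y
      rw [hji, mulVec_smul, smul_smul] at h2
      have e : σ j • (Y *ᵥ w i - c i Y • w i) = σ i • (t • (Y *ᵥ w i) - (c j Y * t) • w i) := by
        rw [h1, h2, smul_smul, smul_smul, mul_comm]
      have e' : σ j • (Y *ᵥ w i - c i Y • w i) - σ i • (t • (Y *ᵥ w i) - (c j Y * t) • w i) = 0 := sub_eq_zero.mpr e
      have : (σ j - σ i * t) • (Y *ᵥ w i) - (σ j * c i Y - σ i * t * c j Y) • w i = 0 := by
        rw [← e']; module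
      exact sub_eq_zero.mp this
    -- a matrix moving `w_i` off its line shows `σ_j = σ_i t`
    obtain ⟨u, hu⟩ := exists_cross_ne_zero hwi
    obtain ⟨r₀, hr₀⟩ := Function.ne_iff.mp hwi
    have hY := key (vecMulVec u (Pi.single r₀ 1))
    rw [vecMulVec_mulVec_eq_smul, single_dotProduct, one_mul, smul_smul] at hY
    have hcross := congrArg (fun v : Fin 2 → k => w i 0 * v 1 - w i 1 * v 0) hY
    simp only [Pi.smul_apply, smul_eq_mul] at hcross
    have hst : (σ j - σ i * t) * (w i r₀ * (w i 0 * u 1 - w i 1 * u 0)) = 0 := by linear_combination hcross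
    have hst' : σ j - σ i * t = 0 := by
      rcases mul_eq_zero.mp hst with h0 | h0
      · exact h0
      · rcases mul_eq_zero.mp h0 with h1 | h1
        · exact absurd h1 hr₀
        · exact absurd h1 hu
    -- then the `w_i`-coefficient vanishes for every `X`
    have hX := key X
    rw [hst', zero_smul] at hX
    have hcoef : (σ j * c i X - σ i * t * c j X) * w i r₀ = 0 := by
      have := congr_fun hX r₀
      simp only [Pi.zero_apply, Pi.smul_apply, smul_eq_mul] at this
      linear_combination -this
    rcases mul_eq_zero.mp hcoef with h0 | h0
    · have hσj : σ j = σ i * t := sub_eq_zero.mp hst'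
      rw [hσj] at h0
      have : σ i * t * (c i X - c j X) = 0 := by linear_combination h0
      rcases mul_eq_zero.mp this with h1 | h1
      · rcases mul_eq_zero.mp h1 with h2 | h2
        · exact absurd h2 hσi
        · exact absurd h2 ht
      · linear_combination -h1
    · exact absurd h0 hr₀
  -- S9: the two classes `f_{j₁}, f_{j₂}` cannot separate `M₂(k)`
  let L : Matrix (Fin 2) (Fin 2) k →ₗ[k] k × k := LinearMap.prod (β.f j₁) (β.f j₂)
  have hker : LinearMap.ker L ≠ ⊥ := by
    apply LinearMap.ker_ne_bot_of_finrank_lt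
    rw [finrank_matrix_fin, Module.finrank_prod, Module.finrank_self]; norm_num
  obtain ⟨X₀, hX₀ker, hX₀⟩ := Submodule.exists_mem_ne_zero_of_ne_bot hker
  have hf₁ : β.f j₁ X₀ = 0 := (Prod.mk_eq_zero.mp (LinearMap.mem_ker.mp hX₀ker)).1
  have hf₂ : β.f j₂ X₀ = 0 := (Prod.mk_eq_zero.mp (LinearMap.mem_ker.mp hX₀ker)).2
  -- every off term with a nonzero column `q` has `f_s(X₀) = 0`
  have hfs : ∀ s ∈ O, w s ≠ 0 → β.f s X₀ = 0 := by
    intro s hs hws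
    have hcs : c s X₀ = 0 := by
      rcases hdir s hs hws with ⟨_, hs1⟩ | ⟨_, hs2⟩
      · have ht : d' ⬝ᵥ w s ≠ 0 := by intro h0; apply hws; rw [hs1, h0, zero_smul]
        rw [hsame j₁ hj₁ s hs hw₁ _ ht hs1 X₀]; simp only [hc, hf₁, zero_mul]
      · have ht : d ⬝ᵥ w s ≠ 0 := by intro h0; apply hws; rw [hs2, h0, zero_smul]
        rw [hsame j₂ hj₂ s hs hw₂ _ ht hs2 X₀]; simp only [hc, hf₂, zero_mul]
    have : β.f s X₀ = c s X₀ * β.f s 1 := by simp only [hc]; rw [mul_assoc, inv_mul_cancel₀ (hO' s hs), mul_one]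
    rw [this, hcs, zero_mul]
  -- S10: column `q` of Brent at `X₀`: `X₀ y = 0` for every `y`, so `X₀ = 0`
  have hzero : ∀ y : Fin 2 → k, X₀ *ᵥ y = 0 := by
    intro y
    let Y : Matrix (Fin 2) (Fin n) k := fun r c' => if c' = q then y r else 0
    have hB := β.map_eq_sum X₀ Y
    rw [mulBilin_apply] at hB
    funext r
    have hr := congr_fun (congr_fun hB r) q
    rw [mul_apply_col] at hr
    have hyq : (fun r' => Y r' q) = y := by funext r'; simp [Y]
    rw [hyq] at hr
    rw [hr, Matrix.sum_apply, Pi.zero_apply]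
    refine Finset.sum_eq_zero fun t _ => ?_
    rw [Matrix.smul_apply, smul_eq_mul]
    by_cases ht : t ∈ O
    · by_cases hwt : w t = 0
      · have : β.w t r q = 0 := by simpa [hw] using congr_fun hwt r
        rw [this, mul_zero]
      · rw [hfs t ht hwt, zero_mul, zero_mul]
    · rw [hq t ht r, mul_zero]
  apply hX₀
  ext r r'
  have := congr_fun (hzero (Pi.single r' 1)) r
  simpa [mulVec, dotProduct, Pi.single_apply, Fin.sum_univ_two] using this

end Summit.MatrixMultiplication.OmegaCensus.SmallFormats
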